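import Literature.NumberTheory.Automorphic.ArtinLFunctionsBrauerAssembly
import Literature.NumberTheory.GaloisRepresentations.ArtinReciprocityCharacterProofs
import Literature.NumberTheory.LFunctions.RayClassCharacterProofs
import HarnessLib

/-!
# Artin–Brauer meromorphy from Artin reciprocity alone (Hecke's theorem discharged)
(companion to `Literature.NumberTheory.Automorphic.ArtinLFunctionsBrauerAssembly`; serves the named
fact `Literature.NumberTheory.Automorphic.artin_brauer_hasMeromorphicContinuation`, **lang.S29**)

Brauer, *On Artin's L-series with general group characters*, Ann. of Math. 48 (1947), Thm. 1 and
its application; Neukirch, *Algebraic Number Theory*, VII, proof of (12.6).  The assembly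
`artin_brauer_hasMeromorphicContinuation_of_reciprocity_of_hecke` takes two named facts, for every
number field `M` in the universe of `K`: Artin reciprocity for characters of degree one
(`artinReciprocity_rankOne M`) and Hecke's continuation of ray class L-series
(`rayClassLSeries_hasMeromorphicContinuation M`).  The second is now PROVED in the tree
(`LFunctions.rayClassLSeries_hasMeromorphicContinuation_holds`: theta transformation formula,
Mellin transform and unit-orbit unfolding of the partial zeta functions of the narrow ray classes,
Neukirch VII §8 (8.1)–(8.6) with Remark 1 — Hecke 1917).  Hence:

* PROVED `artin_brauer_hasMeromorphicContinuation_of_reciprocity` — Brauer's theorem conditional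
  only on Artin reciprocity (global class field theory, Neukirch VI (7.1)/VII (10.3)), for `K` in any
  universe;
* PROVED `artin_brauer_hasMeromorphicContinuation_of_artinReciprocity_character` — the same from the
  idelic reciprocity law for characters (`GaloisRepresentations.artinReciprocity_character`, Tate's
  form, Cassels–Fröhlich VII §5), for number fields `K : Type` (the universe over which that fact
  quantifies), via `artinReciprocity_rankOne_of_artinReciprocity_character`.

So the named fact `artin_brauer_hasMeromorphicContinuation` is reduced to exactly one named fact of
the tree: Artin reciprocity.

## References

* R. Brauer, *On Artin's L-series with general group characters*, Ann. of Math. 48 (1947), 502–514,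
  Thm. 1. [Brauer1947]
* J. Neukirch, *Algebraic Number Theory*, Grundlehren 322, Springer 1999, Ch. VII §8 (8.5)–(8.6),
  §10 (10.3)–(10.6), §12 proof of (12.6); Ch. VI §7 (7.1). [NeukirchANT1999]
-/

noncomputable section

namespace Literature.NumberTheory.Automorphic

universe u w

section AnyUniverse

variable {K : Type u} [Field K] [NumberField K] {V : Type w} [AddCommGroup V] [Module ℂ V]
  [TopologicalSpace V] [FiniteDimensional ℂ V]

/-- **Artin–Brauer meromorphy from Artin reciprocity** (Brauer 1947, Thm. 1 and its application;
Neukirch VII, proof of (12.6)): granting Artin reciprocity for characters of degree one of `Γ_M` for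
every number field `M` in the universe of `K` (`artinReciprocity_rankOne M`, class field theory), the
Artin L-function of every Artin representation `ρ : Γ_K → GL(V)` on a finite-dimensional `V` (module
topology) has a meromorphic continuation to `ℂ`.  Hecke's theorem, the other input of
`artin_brauer_hasMeromorphicContinuation_of_reciprocity_of_hecke`, is supplied by the tree
(`LFunctions.rayClassLSeries_hasMeromorphicContinuation_holds`).
[cite: Brauer1947, Thm. 1] [cite: NeukirchANT1999, VII proof of (12.6), (10.3) and (8.5)–(8.6)] -/
theorem artin_brauer_hasMeromorphicContinuation_of_reciprocity
    (hR : ∀ (M : Type u) [Field M] [NumberField M],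
      GaloisRepresentations.artinReciprocity_rankOne M) :
    artin_brauer_hasMeromorphicContinuation (K := K) (V := V) :=
  artin_brauer_hasMeromorphicContinuation_of_reciprocity_of_hecke hR
    fun M _ _ => LFunctions.rayClassLSeries_hasMeromorphicContinuation_holds M

end AnyUniverse

section TateForm

variable {K : Type} [Field K] [NumberField K] {V : Type w} [AddCommGroup V] [Module ℂ V]
  [TopologicalSpace V] [FiniteDimensional ℂ V]

/-- **Artin–Brauer meromorphy from the idelic reciprocity law for characters** (Tate's form
`GaloisRepresentations.artinReciprocity_character`, Cassels–Fröhlich VII §5.1; for number fields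
`K : Type`): by Neukirch's deduction of the ideal-theoretic law VI (7.1) from VI (5.5)
(`artinReciprocity_rankOne_of_artinReciprocity_character`) and
`artin_brauer_hasMeromorphicContinuation_of_reciprocity`.
[cite: Brauer1947, Thm. 1] [cite: NeukirchANT1999, VII proof of (12.6); VI §7 Thm. (7.1)] -/
theorem artin_brauer_hasMeromorphicContinuation_of_artinReciprocity_character
    (hR : GaloisRepresentations.artinReciprocity_character) :
    artin_brauer_hasMeromorphicContinuation (K := K) (V := V) :=
  artin_brauer_hasMeromorphicContinuation_of_reciprocity
    fun M _ _ => GaloisRepresentations.artinReciprocity_rankOne_of_artinReciprocity_character hR M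

end TateForm

end Literature.NumberTheory.Automorphic

end
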